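import Literature.MathematicalPhysics.QuantumFieldTheory.Balaban1983to89.B1Eq324BenfattoKernelSect5FreeStep
import Literature.MathematicalPhysics.QuantumFieldTheory.Balaban1983to89.B1Eq324BenfattoSect5Identification
import HarnessLib

/-!
# `Balaban1983to89.B1Eq324BenfattoKernelSect5Identification` — [BenfattoEtAl1978] §5 pp. 158–159, (5.31)–(5.35) summed over the tesserae, FOR THE
# REFERENCE GAUSSIAN `𝒩(0,K)` OF A GENERAL KERNEL: the extracted per-box exponents of one pavement step identified with the cumulant difference
# «current Hamiltonian minus handed-on Hamiltonian» under `μ_K`, EXACTLY, with the four correction terms displayed — obligation (O1)/(O1′) of the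
# class chain's assembly as an identity plus two triangle inequalities

statement-level skeleton of published theorems with citation tags; proofs where landed; nothing here is a claim about the
Yang–Mills mass gap

WHY THIS MODULE (cell `pub-ymgap`, seat `dag-n08-c` gen 31; node N08 [Balaban1985UV3]; the [BenfattoEtAl1978] source chain behind the (α)-row `h324`;
the ASSEMBLY layer over the class chain — structural S8 of `N08-PORT-MAP-STRUCTURAL-SIDE.md`, cluster rows 8–10 of `N08-PORT-MAP-CLUSTER-SIDE.md`).
The concrete `…Sect5Identification` identifies `Σ_□E(□)` — the reference-cumulant numbers of the per-box relation — with the free-cumulant telescope of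
the free field `P̂₀`.  On the class road the per-box numbers `E_□` of `…KernelSect5PerBoxAtPavement.hbox_of_clusterRows` are cumulants under the CLASS
FIELD `𝒩(0,K)` itself (K_REF OF RECORD `K_Λ`, seat n08-b `N08-CLASS-TOOLKIT.md` §6), and n08-b's `…KernelSect5FreeStep` (p610935) proves the two identities
behind the telescope for `𝒩(0,K)` of ANY positive-semidefinite kernel with a diagonal bound on `J` (`perBoxE_eq_sum_truncatedExp_sub_kernel`,
`sum_truncatedExp_sub_eq_telescope_kernel`).  This file is the token map `P̂₀ ↦ 𝒩(0,K)` of the concrete module over those two: the SAME proofs, the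
free field's `(hα, hβ)` replaced by the rows `hK : IsPosSemidefKernel K`, `hc : ∀ y ∈ J, K y y ≤ c`; the measure-generic re-indexing
`…Sect5Identification.cumulantSum_sub_eq_sum_range` is used BY NAME.

DICTIONARY.  `Ê_K^T(S;k)` ↦ `truncatedExp (gaussianFieldOfKernel K) S k`; the classes of `□_m` as the explicit triple `![T0,T1,T2]`; the palette of the
telescope `Option (↥B × Bool)` passed as a function `Y` with its three identifications `hYn / hYf / hYt` (as in `…KernelSect5FreeStep`).

WHAT IS PROVED (theorems only; no definition, no named fact, no `sorry`; axioms standard).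
* ★★ `sum_perBoxE_eq` — `Σ_{m∈B} E(m) = [cumulantSum μ_K H^A_J t − cumulantSum μ_K H^A_{Γ̄₁(B)} t] − Σ_{k<t} D_k/(k+1)!` with the four-term `D_k` displayed;
  ★ `identification_lower` ((O1) for any per-box errors `Err`), ★ `identification_upper` ((O1′)).

HONEST SCOPE / NOT HERE.  Exact bookkeeping over landed identities; the bounds on the four displayed terms (class editions of `…HlCumulants` /
`…Psi3Cumulants` / `…Eq534Cumulants` / `…FreeStepCross` — seat n08-b) and the ledger are NOT here; one self-located piece of an UNCOMMISSIONED port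
(plan g81 (II), START-LIST v11 §n08) — nothing chained; no generalised Basic Lemma is stated; nothing of [Balaban1985UV3] is asserted; count-neutral for
N08; nothing about d = 4, the continuum, OS axioms, a mass gap or the Clay problem.
-/

noncomputable section

open MeasureTheory ProbabilityTheory Finset
open scoped BigOperators Nat NNReal

namespace Literature.MathematicalPhysics.QuantumFieldTheory.Balaban1983to89.B1Eq324BenfattoKernelSect5Identification

open _root_.MeasureTheory _root_.ProbabilityTheory
open Literature.Probability.LatticeModels (setPartitions ursellOf cumulantOf)
open Literature.MathematicalPhysics.QuantumFieldTheory
open Literature.MathematicalPhysics.QuantumFieldTheory.Balaban1983to89.B1Eq324BenfattoLemma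
open Literature.MathematicalPhysics.QuantumFieldTheory.Balaban1983to89.B1Eq324BenfattoSect5Boxes
open Literature.MathematicalPhysics.QuantumFieldTheory.Balaban1983to89.B1Eq324BenfattoSect5Eq511
open Literature.MathematicalPhysics.QuantumFieldTheory.Balaban1983to89.B1Eq324BenfattoSect5Eq524
open Literature.MathematicalPhysics.QuantumFieldTheory.Balaban1983to89.B1Eq324BenfattoSect5Eq534
open Literature.MathematicalPhysics.QuantumFieldTheory.Balaban1983to89.B1Eq324BenfattoKernelSect5FreeStep
  (perBoxE_eq_sum_truncatedExp_sub_kernel sum_truncatedExp_sub_eq_telescope_kernel)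
open Literature.MathematicalPhysics.QuantumFieldTheory.Balaban1983to89.B1Eq324BenfattoSect5Identification (cumulantSum_sub_eq_sum_range)

variable {d : ℕ}

section Identification

variable {K : B1Eq324BenfattoLemma.Site d → B1Eq324BenfattoLemma.Site d → ℝ} {s D : ℕ} {κ : ℝ} {a : Coef d} {J : Finset (B1Eq324BenfattoLemma.Site d)} {L w v : ℕ}
  {B : Finset (B1Eq324BenfattoLemma.Site d)}

/-- **THE EXTRACTED EXPONENTS OF ONE PAVEMENT STEP, SUMMED OVER THE TESSERAE, AGAINST THE TWO HAMILTONIANS THE CHAIN SEES — EXACTLY**: for `A` supported in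
`J`, the boxes `□_m, m ∈ B`, the three classes `Ψ′₁(m), Ψ″₁(m), Ψ₂(m)` and `t`,
`Σ_{m∈B} E(m) = [cumulantSum μ_K H^A_J t − cumulantSum μ_K H^A_{Γ̄₁(B)} t] − Σ_{k<t} D_k/(k+1)!`,
`D_k = (Ê_K^T(H_J;k+1) − Ê_K^T(X;k+1)) − (Ê_K^T(H_{Γ̄₁};k+1) − Ê_K^T(Y;k+1)) + CROSS_k + Σ_{m∈B}W₂₉,k(m)`, `X = H_{Γ₁}+Σ_m(Ψ₁+Ψ₂)(m)`, `Y = H_{Γ₁}+Σ_m(Ψ′₁+Ψ₂)(m)`,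
CROSS and `W₂₉` the sums of `…FreeStep.sum_truncatedExp_sub_eq_telescope` (dag-n08-b's `perBoxE_eq_sum_truncatedExp_sub` per box, the telescope per order, the
orders summed with weights `1/(k+1)!`). [cite: BenfattoEtAl1978, (5.31)–(5.35) pp.158–159, (4.7) p.152] -/
theorem sum_perBoxE_eq (hK : IsPosSemidefKernel K) {c : ℝ≥0} (hc : ∀ y ∈ J, K y y ≤ c)
    (hJ : CoefSupportedIn a J)
    (Y : Option (↥B × Bool) → (B1Eq324BenfattoLemma.Site d → ℝ) → ℝ)
    (hYn : Y none = fun z => hamiltonian s D κ a (corridors L w B) z)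
    (hYf : ∀ m : ↥B, Y (some (m, false)) = fun z => psi1p s D κ a L w v m z + psi2 s D κ a L w m z)
    (hYt : ∀ m : ↥B, Y (some (m, true)) = fun z => psi1pp s D κ a L w v m z) (t : ℕ) :
    ∑ m ∈ B, ∑ k ∈ Finset.range t,
        (∑ f ∈ univ.filter (fun f : Fin (k + 1) → Fin 3 => (∃ j, f j = 1) ∧ ∀ j, f j ≠ 2),
          ursellOf (fun P : Finset (Fin (k + 1)) => ∫ z, ∏ j ∈ P,
            (∑ p ∈ Finset.Icc 1 s, ∑ Δ ∈ (![fun p => tuplesIn J p (frame4 L w v m) ∪ crossT J p (frame4 L w v m) (frame3 L w v m),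
                fun p => (tuplesIn J p (core L w m) \ tuplesIn J p (frame4 L w v m)) ∪
                  (crossT J p (core L w m) (frame3 L w v m) \ crossT J p (frame4 L w v m) (frame3 L w v m)),
                fun p => crossT J p (frame1 L w m) (frame2 L w m) ∪ tuplesIn J p (frame2 L w m)] :
                  Fin 3 → (p : ℕ) → Finset (Fin p → J)) (f j) p,
              ∑ n ∈ admissible p D, term κ a z p Δ n) ∂gaussianFieldOfKernel K) univ) / (k + 1)! =
      (cumulantSum (gaussianFieldOfKernel K) (hamiltonian s D κ a J) t - cumulantSum (gaussianFieldOfKernel K) (hamiltonian s D κ a (corridorsBar L w v B)) t)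
        - ∑ k ∈ Finset.range t,
          (((truncatedExp (gaussianFieldOfKernel K) (hamiltonian s D κ a J) (k + 1)
              - truncatedExp (gaussianFieldOfKernel K)
                  (fun z => hamiltonian s D κ a (corridors L w B) z + ∑ m ∈ B, (psi1 s D κ a L w v m z + psi2 s D κ a L w m z)) (k + 1))
            - (truncatedExp (gaussianFieldOfKernel K) (hamiltonian s D κ a (corridorsBar L w v B)) (k + 1)
              - truncatedExp (gaussianFieldOfKernel K)
                  (fun z => hamiltonian s D κ a (corridors L w B) z + ∑ m ∈ B, (psi1p s D κ a L w v m z + psi2 s D κ a L w m z)) (k + 1)))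
            + ∑ f ∈ univ.filter (fun f : Fin (k + 1) → Option (↥B × Bool) =>
                (∃ j m, f j = some (m, true)) ∧ ¬∃ m, ∀ j, f j = some (m, false) ∨ f j = some (m, true)),
                ursellOf (fun P : Finset (Fin (k + 1)) => ∫ z, ∏ j ∈ P, Y (f j) z ∂gaussianFieldOfKernel K) univ
            + ∑ m ∈ B, ∑ f ∈ univ.filter (fun f : Fin (k + 1) → Fin 3 => (∃ j, f j = 1) ∧ ∃ j, f j = 2),
                ursellOf (fun P : Finset (Fin (k + 1)) => ∫ z, ∏ j ∈ P,
                  (![fun z => psi1p s D κ a L w v m z, fun z => psi1pp s D κ a L w v m z, fun z => psi2 s D κ a L w m z] (f j)) z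
                    ∂gaussianFieldOfKernel K) univ) / (k + 1)! := by
  -- per box: `E(m) = Σ_k [T₀(Ψ₁(m)) − T₀(Ψ′₁(m))]/(k+1)!`
  have hbox : ∀ m ∈ B, ∑ k ∈ Finset.range t,
      (∑ f ∈ univ.filter (fun f : Fin (k + 1) → Fin 3 => (∃ j, f j = 1) ∧ ∀ j, f j ≠ 2),
        ursellOf (fun P : Finset (Fin (k + 1)) => ∫ z, ∏ j ∈ P,
          (∑ p ∈ Finset.Icc 1 s, ∑ Δ ∈ (![fun p => tuplesIn J p (frame4 L w v m) ∪ crossT J p (frame4 L w v m) (frame3 L w v m),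
              fun p => (tuplesIn J p (core L w m) \ tuplesIn J p (frame4 L w v m)) ∪
                (crossT J p (core L w m) (frame3 L w v m) \ crossT J p (frame4 L w v m) (frame3 L w v m)),
              fun p => crossT J p (frame1 L w m) (frame2 L w m) ∪ tuplesIn J p (frame2 L w m)] :
                Fin 3 → (p : ℕ) → Finset (Fin p → J)) (f j) p,
            ∑ n ∈ admissible p D, term κ a z p Δ n) ∂gaussianFieldOfKernel K) univ) / (k + 1)! =
      ∑ k ∈ Finset.range t,
        (truncatedExp (gaussianFieldOfKernel K) (psi1 s D κ a L w v m) (k + 1) - truncatedExp (gaussianFieldOfKernel K) (psi1p s D κ a L w v m) (k + 1)) / (k + 1)! :=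
    fun m _ => perBoxE_eq_sum_truncatedExp_sub_kernel (s := s) (D := D) (κ := κ) (L := L) (w := w) (v := v) (m := m) hK hc hJ _
      (fun p => rfl) (fun p => rfl) t
  rw [Finset.sum_congr rfl hbox, Finset.sum_comm]
  -- per order: the telescope
  have htel : ∀ k, ∑ m ∈ B, (truncatedExp (gaussianFieldOfKernel K) (psi1 s D κ a L w v m) (k + 1)
      - truncatedExp (gaussianFieldOfKernel K) (psi1p s D κ a L w v m) (k + 1)) = _ :=
    fun k => sum_truncatedExp_sub_eq_telescope_kernel (s := s) (D := D) (κ := κ) (L := L) (w := w) (v := v) (B := B) hK hc hJ Y hYn hYf hYt k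
  have hk : ∀ k ∈ Finset.range t, ∑ m ∈ B, (truncatedExp (gaussianFieldOfKernel K) (psi1 s D κ a L w v m) (k + 1)
      - truncatedExp (gaussianFieldOfKernel K) (psi1p s D κ a L w v m) (k + 1)) / ((k + 1)! : ℝ) =
      (∑ m ∈ B, (truncatedExp (gaussianFieldOfKernel K) (psi1 s D κ a L w v m) (k + 1)
        - truncatedExp (gaussianFieldOfKernel K) (psi1p s D κ a L w v m) (k + 1))) / ((k + 1)! : ℝ) := fun k _ => by
    rw [Finset.sum_div]
  rw [Finset.sum_congr rfl hk]
  simp only [htel]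
  rw [cumulantSum_sub_eq_sum_range, ← Finset.sum_sub_distrib]
  refine Finset.sum_congr rfl fun k _ => ?_
  rw [← sub_div]
  congr 1
  ring

/-- **(O1) — THE LOWER IDENTIFICATION BOUND, for any per-box errors `Err(□)`**: with
`idErr := Σ_{m∈B}Err(m) + Σ_{k<t}(|Ê_K^T(H_J)−Ê_K^T(X)| + |Ê_K^T(H_{Γ̄₁})−Ê_K^T(Y)| + |CROSS_k| + |Σ_mW₂₉,k(m)|)/(k+1)!`,
`[cumulantSum μ_K H^A_J t − cumulantSum μ_K H^A_{Γ̄₁(B)} t] − idErr ≤ Σ_{m∈B}(E(m) − Err(m))` — the `hE` of `…Sect5CollectErrors.ineq47_of_chain` with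
`ℓ(□) := E(□) − Err(□)`. [cite: BenfattoEtAl1978, (5.31)–(5.35) pp.158–159, (4.7) p.152] -/
theorem identification_lower (hK : IsPosSemidefKernel K) {c : ℝ≥0} (hc : ∀ y ∈ J, K y y ≤ c)
    (hJ : CoefSupportedIn a J)
    (Y : Option (↥B × Bool) → (B1Eq324BenfattoLemma.Site d → ℝ) → ℝ)
    (hYn : Y none = fun z => hamiltonian s D κ a (corridors L w B) z)
    (hYf : ∀ m : ↥B, Y (some (m, false)) = fun z => psi1p s D κ a L w v m z + psi2 s D κ a L w m z)
    (hYt : ∀ m : ↥B, Y (some (m, true)) = fun z => psi1pp s D κ a L w v m z) (t : ℕ) (Err : B1Eq324BenfattoLemma.Site d → ℝ) :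
    (cumulantSum (gaussianFieldOfKernel K) (hamiltonian s D κ a J) t - cumulantSum (gaussianFieldOfKernel K) (hamiltonian s D κ a (corridorsBar L w v B)) t)
        - (∑ m ∈ B, Err m + ∑ k ∈ Finset.range t,
            (|truncatedExp (gaussianFieldOfKernel K) (hamiltonian s D κ a J) (k + 1)
                - truncatedExp (gaussianFieldOfKernel K)
                    (fun z => hamiltonian s D κ a (corridors L w B) z + ∑ m ∈ B, (psi1 s D κ a L w v m z + psi2 s D κ a L w m z)) (k + 1)|
              + |truncatedExp (gaussianFieldOfKernel K) (hamiltonian s D κ a (corridorsBar L w v B)) (k + 1)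
                - truncatedExp (gaussianFieldOfKernel K)
                    (fun z => hamiltonian s D κ a (corridors L w B) z + ∑ m ∈ B, (psi1p s D κ a L w v m z + psi2 s D κ a L w m z)) (k + 1)|
              + |∑ f ∈ univ.filter (fun f : Fin (k + 1) → Option (↥B × Bool) =>
                  (∃ j m, f j = some (m, true)) ∧ ¬∃ m, ∀ j, f j = some (m, false) ∨ f j = some (m, true)),
                  ursellOf (fun P : Finset (Fin (k + 1)) => ∫ z, ∏ j ∈ P, Y (f j) z ∂gaussianFieldOfKernel K) univ|
              + |∑ m ∈ B, ∑ f ∈ univ.filter (fun f : Fin (k + 1) → Fin 3 => (∃ j, f j = 1) ∧ ∃ j, f j = 2),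
                  ursellOf (fun P : Finset (Fin (k + 1)) => ∫ z, ∏ j ∈ P,
                    (![fun z => psi1p s D κ a L w v m z, fun z => psi1pp s D κ a L w v m z, fun z => psi2 s D κ a L w m z] (f j)) z
                      ∂gaussianFieldOfKernel K) univ|) / (k + 1)!) ≤
      ∑ m ∈ B, (∑ k ∈ Finset.range t,
        (∑ f ∈ univ.filter (fun f : Fin (k + 1) → Fin 3 => (∃ j, f j = 1) ∧ ∀ j, f j ≠ 2),
          ursellOf (fun P : Finset (Fin (k + 1)) => ∫ z, ∏ j ∈ P,
            (∑ p ∈ Finset.Icc 1 s, ∑ Δ ∈ (![fun p => tuplesIn J p (frame4 L w v m) ∪ crossT J p (frame4 L w v m) (frame3 L w v m),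
                fun p => (tuplesIn J p (core L w m) \ tuplesIn J p (frame4 L w v m)) ∪
                  (crossT J p (core L w m) (frame3 L w v m) \ crossT J p (frame4 L w v m) (frame3 L w v m)),
                fun p => crossT J p (frame1 L w m) (frame2 L w m) ∪ tuplesIn J p (frame2 L w m)] :
                  Fin 3 → (p : ℕ) → Finset (Fin p → J)) (f j) p,
              ∑ n ∈ admissible p D, term κ a z p Δ n) ∂gaussianFieldOfKernel K) univ) / (k + 1)! - Err m) := by
  rw [Finset.sum_sub_distrib, sum_perBoxE_eq hK hc hJ Y hYn hYf hYt t]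
  have hD : ∀ k ∈ Finset.range t,
      (((truncatedExp (gaussianFieldOfKernel K) (hamiltonian s D κ a J) (k + 1)
          - truncatedExp (gaussianFieldOfKernel K)
              (fun z => hamiltonian s D κ a (corridors L w B) z + ∑ m ∈ B, (psi1 s D κ a L w v m z + psi2 s D κ a L w m z)) (k + 1))
        - (truncatedExp (gaussianFieldOfKernel K) (hamiltonian s D κ a (corridorsBar L w v B)) (k + 1)
          - truncatedExp (gaussianFieldOfKernel K)
              (fun z => hamiltonian s D κ a (corridors L w B) z + ∑ m ∈ B, (psi1p s D κ a L w v m z + psi2 s D κ a L w m z)) (k + 1)))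
        + ∑ f ∈ univ.filter (fun f : Fin (k + 1) → Option (↥B × Bool) =>
            (∃ j m, f j = some (m, true)) ∧ ¬∃ m, ∀ j, f j = some (m, false) ∨ f j = some (m, true)),
            ursellOf (fun P : Finset (Fin (k + 1)) => ∫ z, ∏ j ∈ P, Y (f j) z ∂gaussianFieldOfKernel K) univ
        + ∑ m ∈ B, ∑ f ∈ univ.filter (fun f : Fin (k + 1) → Fin 3 => (∃ j, f j = 1) ∧ ∃ j, f j = 2),
            ursellOf (fun P : Finset (Fin (k + 1)) => ∫ z, ∏ j ∈ P,
              (![fun z => psi1p s D κ a L w v m z, fun z => psi1pp s D κ a L w v m z, fun z => psi2 s D κ a L w m z] (f j)) z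
                ∂gaussianFieldOfKernel K) univ) / (k + 1)! ≤
      (|truncatedExp (gaussianFieldOfKernel K) (hamiltonian s D κ a J) (k + 1)
          - truncatedExp (gaussianFieldOfKernel K)
              (fun z => hamiltonian s D κ a (corridors L w B) z + ∑ m ∈ B, (psi1 s D κ a L w v m z + psi2 s D κ a L w m z)) (k + 1)|
        + |truncatedExp (gaussianFieldOfKernel K) (hamiltonian s D κ a (corridorsBar L w v B)) (k + 1)
          - truncatedExp (gaussianFieldOfKernel K)
              (fun z => hamiltonian s D κ a (corridors L w B) z + ∑ m ∈ B, (psi1p s D κ a L w v m z + psi2 s D κ a L w m z)) (k + 1)|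
        + |∑ f ∈ univ.filter (fun f : Fin (k + 1) → Option (↥B × Bool) =>
            (∃ j m, f j = some (m, true)) ∧ ¬∃ m, ∀ j, f j = some (m, false) ∨ f j = some (m, true)),
            ursellOf (fun P : Finset (Fin (k + 1)) => ∫ z, ∏ j ∈ P, Y (f j) z ∂gaussianFieldOfKernel K) univ|
        + |∑ m ∈ B, ∑ f ∈ univ.filter (fun f : Fin (k + 1) → Fin 3 => (∃ j, f j = 1) ∧ ∃ j, f j = 2),
            ursellOf (fun P : Finset (Fin (k + 1)) => ∫ z, ∏ j ∈ P,
              (![fun z => psi1p s D κ a L w v m z, fun z => psi1pp s D κ a L w v m z, fun z => psi2 s D κ a L w m z] (f j)) z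
                ∂gaussianFieldOfKernel K) univ|) / (k + 1)! := by
    intro k _
    have hfac : (0 : ℝ) < (k + 1)! := by exact_mod_cast Nat.factorial_pos (k + 1)
    refine div_le_div_of_nonneg_right ?_ hfac.le
    have h1 := le_abs_self (truncatedExp (gaussianFieldOfKernel K) (hamiltonian s D κ a J) (k + 1)
          - truncatedExp (gaussianFieldOfKernel K)
              (fun z => hamiltonian s D κ a (corridors L w B) z + ∑ m ∈ B, (psi1 s D κ a L w v m z + psi2 s D κ a L w m z)) (k + 1))
    have h2 := neg_abs_le (truncatedExp (gaussianFieldOfKernel K) (hamiltonian s D κ a (corridorsBar L w v B)) (k + 1)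
          - truncatedExp (gaussianFieldOfKernel K)
              (fun z => hamiltonian s D κ a (corridors L w B) z + ∑ m ∈ B, (psi1p s D κ a L w v m z + psi2 s D κ a L w m z)) (k + 1))
    have h3 := le_abs_self (∑ f ∈ univ.filter (fun f : Fin (k + 1) → Option (↥B × Bool) =>
            (∃ j m, f j = some (m, true)) ∧ ¬∃ m, ∀ j, f j = some (m, false) ∨ f j = some (m, true)),
            ursellOf (fun P : Finset (Fin (k + 1)) => ∫ z, ∏ j ∈ P, Y (f j) z ∂gaussianFieldOfKernel K) univ)
    have h4 := le_abs_self (∑ m ∈ B, ∑ f ∈ univ.filter (fun f : Fin (k + 1) → Fin 3 => (∃ j, f j = 1) ∧ ∃ j, f j = 2),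
            ursellOf (fun P : Finset (Fin (k + 1)) => ∫ z, ∏ j ∈ P,
              (![fun z => psi1p s D κ a L w v m z, fun z => psi1pp s D κ a L w v m z, fun z => psi2 s D κ a L w m z] (f j)) z
                ∂gaussianFieldOfKernel K) univ)
    linarith
  have hsum := Finset.sum_le_sum hD
  linarith

/-- **(O1′) — THE UPPER IDENTIFICATION BOUND, for any per-box errors `Err(□)`**: with the same `idErr`,
`Σ_{m∈B}(E(m) + Err(m)) ≤ [cumulantSum μ_K H^A_J t − cumulantSum μ_K H^A_{Γ̄₁(B)} t] + idErr` — the `hE` of `…Sect5PavementChainUpper.ineq46_of_chain` with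
`u(□) := E(□) + Err(□)`. [cite: BenfattoEtAl1978, (5.36) p.159, (4.6) p.152] -/
theorem identification_upper (hK : IsPosSemidefKernel K) {c : ℝ≥0} (hc : ∀ y ∈ J, K y y ≤ c)
    (hJ : CoefSupportedIn a J)
    (Y : Option (↥B × Bool) → (B1Eq324BenfattoLemma.Site d → ℝ) → ℝ)
    (hYn : Y none = fun z => hamiltonian s D κ a (corridors L w B) z)
    (hYf : ∀ m : ↥B, Y (some (m, false)) = fun z => psi1p s D κ a L w v m z + psi2 s D κ a L w m z)
    (hYt : ∀ m : ↥B, Y (some (m, true)) = fun z => psi1pp s D κ a L w v m z) (t : ℕ) (Err : B1Eq324BenfattoLemma.Site d → ℝ) :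
    ∑ m ∈ B, (∑ k ∈ Finset.range t,
        (∑ f ∈ univ.filter (fun f : Fin (k + 1) → Fin 3 => (∃ j, f j = 1) ∧ ∀ j, f j ≠ 2),
          ursellOf (fun P : Finset (Fin (k + 1)) => ∫ z, ∏ j ∈ P,
            (∑ p ∈ Finset.Icc 1 s, ∑ Δ ∈ (![fun p => tuplesIn J p (frame4 L w v m) ∪ crossT J p (frame4 L w v m) (frame3 L w v m),
                fun p => (tuplesIn J p (core L w m) \ tuplesIn J p (frame4 L w v m)) ∪
                  (crossT J p (core L w m) (frame3 L w v m) \ crossT J p (frame4 L w v m) (frame3 L w v m)),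
                fun p => crossT J p (frame1 L w m) (frame2 L w m) ∪ tuplesIn J p (frame2 L w m)] :
                  Fin 3 → (p : ℕ) → Finset (Fin p → J)) (f j) p,
              ∑ n ∈ admissible p D, term κ a z p Δ n) ∂gaussianFieldOfKernel K) univ) / (k + 1)! + Err m) ≤
      (cumulantSum (gaussianFieldOfKernel K) (hamiltonian s D κ a J) t - cumulantSum (gaussianFieldOfKernel K) (hamiltonian s D κ a (corridorsBar L w v B)) t)
        + (∑ m ∈ B, Err m + ∑ k ∈ Finset.range t,
            (|truncatedExp (gaussianFieldOfKernel K) (hamiltonian s D κ a J) (k + 1)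
                - truncatedExp (gaussianFieldOfKernel K)
                    (fun z => hamiltonian s D κ a (corridors L w B) z + ∑ m ∈ B, (psi1 s D κ a L w v m z + psi2 s D κ a L w m z)) (k + 1)|
              + |truncatedExp (gaussianFieldOfKernel K) (hamiltonian s D κ a (corridorsBar L w v B)) (k + 1)
                - truncatedExp (gaussianFieldOfKernel K)
                    (fun z => hamiltonian s D κ a (corridors L w B) z + ∑ m ∈ B, (psi1p s D κ a L w v m z + psi2 s D κ a L w m z)) (k + 1)|
              + |∑ f ∈ univ.filter (fun f : Fin (k + 1) → Option (↥B × Bool) =>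
                  (∃ j m, f j = some (m, true)) ∧ ¬∃ m, ∀ j, f j = some (m, false) ∨ f j = some (m, true)),
                  ursellOf (fun P : Finset (Fin (k + 1)) => ∫ z, ∏ j ∈ P, Y (f j) z ∂gaussianFieldOfKernel K) univ|
              + |∑ m ∈ B, ∑ f ∈ univ.filter (fun f : Fin (k + 1) → Fin 3 => (∃ j, f j = 1) ∧ ∃ j, f j = 2),
                  ursellOf (fun P : Finset (Fin (k + 1)) => ∫ z, ∏ j ∈ P,
                    (![fun z => psi1p s D κ a L w v m z, fun z => psi1pp s D κ a L w v m z, fun z => psi2 s D κ a L w m z] (f j)) z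
                      ∂gaussianFieldOfKernel K) univ|) / (k + 1)!) := by
  rw [Finset.sum_add_distrib, sum_perBoxE_eq hK hc hJ Y hYn hYf hYt t]
  have hD : ∀ k ∈ Finset.range t,
      -((|truncatedExp (gaussianFieldOfKernel K) (hamiltonian s D κ a J) (k + 1)
          - truncatedExp (gaussianFieldOfKernel K)
              (fun z => hamiltonian s D κ a (corridors L w B) z + ∑ m ∈ B, (psi1 s D κ a L w v m z + psi2 s D κ a L w m z)) (k + 1)|
        + |truncatedExp (gaussianFieldOfKernel K) (hamiltonian s D κ a (corridorsBar L w v B)) (k + 1)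
          - truncatedExp (gaussianFieldOfKernel K)
              (fun z => hamiltonian s D κ a (corridors L w B) z + ∑ m ∈ B, (psi1p s D κ a L w v m z + psi2 s D κ a L w m z)) (k + 1)|
        + |∑ f ∈ univ.filter (fun f : Fin (k + 1) → Option (↥B × Bool) =>
            (∃ j m, f j = some (m, true)) ∧ ¬∃ m, ∀ j, f j = some (m, false) ∨ f j = some (m, true)),
            ursellOf (fun P : Finset (Fin (k + 1)) => ∫ z, ∏ j ∈ P, Y (f j) z ∂gaussianFieldOfKernel K) univ|
        + |∑ m ∈ B, ∑ f ∈ univ.filter (fun f : Fin (k + 1) → Fin 3 => (∃ j, f j = 1) ∧ ∃ j, f j = 2),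
            ursellOf (fun P : Finset (Fin (k + 1)) => ∫ z, ∏ j ∈ P,
              (![fun z => psi1p s D κ a L w v m z, fun z => psi1pp s D κ a L w v m z, fun z => psi2 s D κ a L w m z] (f j)) z
                ∂gaussianFieldOfKernel K) univ|) / (k + 1)!) ≤
      (((truncatedExp (gaussianFieldOfKernel K) (hamiltonian s D κ a J) (k + 1)
          - truncatedExp (gaussianFieldOfKernel K)
              (fun z => hamiltonian s D κ a (corridors L w B) z + ∑ m ∈ B, (psi1 s D κ a L w v m z + psi2 s D κ a L w m z)) (k + 1))
        - (truncatedExp (gaussianFieldOfKernel K) (hamiltonian s D κ a (corridorsBar L w v B)) (k + 1)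
          - truncatedExp (gaussianFieldOfKernel K)
              (fun z => hamiltonian s D κ a (corridors L w B) z + ∑ m ∈ B, (psi1p s D κ a L w v m z + psi2 s D κ a L w m z)) (k + 1)))
        + ∑ f ∈ univ.filter (fun f : Fin (k + 1) → Option (↥B × Bool) =>
            (∃ j m, f j = some (m, true)) ∧ ¬∃ m, ∀ j, f j = some (m, false) ∨ f j = some (m, true)),
            ursellOf (fun P : Finset (Fin (k + 1)) => ∫ z, ∏ j ∈ P, Y (f j) z ∂gaussianFieldOfKernel K) univ
        + ∑ m ∈ B, ∑ f ∈ univ.filter (fun f : Fin (k + 1) → Fin 3 => (∃ j, f j = 1) ∧ ∃ j, f j = 2),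
            ursellOf (fun P : Finset (Fin (k + 1)) => ∫ z, ∏ j ∈ P,
              (![fun z => psi1p s D κ a L w v m z, fun z => psi1pp s D κ a L w v m z, fun z => psi2 s D κ a L w m z] (f j)) z
                ∂gaussianFieldOfKernel K) univ) / (k + 1)! := by
    intro k _
    have hfac : (0 : ℝ) < (k + 1)! := by exact_mod_cast Nat.factorial_pos (k + 1)
    rw [← neg_div]
    refine div_le_div_of_nonneg_right ?_ hfac.le
    have h1 := neg_abs_le (truncatedExp (gaussianFieldOfKernel K) (hamiltonian s D κ a J) (k + 1)
          - truncatedExp (gaussianFieldOfKernel K)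
              (fun z => hamiltonian s D κ a (corridors L w B) z + ∑ m ∈ B, (psi1 s D κ a L w v m z + psi2 s D κ a L w m z)) (k + 1))
    have h2 := le_abs_self (truncatedExp (gaussianFieldOfKernel K) (hamiltonian s D κ a (corridorsBar L w v B)) (k + 1)
          - truncatedExp (gaussianFieldOfKernel K)
              (fun z => hamiltonian s D κ a (corridors L w B) z + ∑ m ∈ B, (psi1p s D κ a L w v m z + psi2 s D κ a L w m z)) (k + 1))
    have h3 := neg_abs_le (∑ f ∈ univ.filter (fun f : Fin (k + 1) → Option (↥B × Bool) =>
            (∃ j m, f j = some (m, true)) ∧ ¬∃ m, ∀ j, f j = some (m, false) ∨ f j = some (m, true)),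
            ursellOf (fun P : Finset (Fin (k + 1)) => ∫ z, ∏ j ∈ P, Y (f j) z ∂gaussianFieldOfKernel K) univ)
    have h4 := neg_abs_le (∑ m ∈ B, ∑ f ∈ univ.filter (fun f : Fin (k + 1) → Fin 3 => (∃ j, f j = 1) ∧ ∃ j, f j = 2),
            ursellOf (fun P : Finset (Fin (k + 1)) => ∫ z, ∏ j ∈ P,
              (![fun z => psi1p s D κ a L w v m z, fun z => psi1pp s D κ a L w v m z, fun z => psi2 s D κ a L w m z] (f j)) z
                ∂gaussianFieldOfKernel K) univ)
    linarith
  have hsum := Finset.sum_le_sum hD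
  rw [Finset.sum_neg_distrib] at hsum
  linarith

end Identification

end Literature.MathematicalPhysics.QuantumFieldTheory.Balaban1983to89.B1Eq324BenfattoKernelSect5Identification

end
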